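import Literature.AlgebraicGeometry.Motives.IntegralModelRestrictScalarsSheets
import Literature.AlgebraicGeometry.Motives.IntegralModelActionUnique
import HarnessLib

/-!
# Semilinear endomorphisms of a model over `B` ARE endomorphisms of the restricted model over `A`, with the twisted generic fibre

Topic `Literature/AlgebraicGeometry/Motives`; namespace `Literature.AlgebraicGeometry.Motives.IntegralModel`.  One plumbing `def` (`semilinearHom`)
and theorems; no named fact, no instance, no notation, no `sorry`.  Cell `hodgecm-mathlib`, P6 «MOD programme», sub-desk P6a, GEN layer — organ
«SEMILIN» (G2) (desk F0P6a-plan (g0) «= G2 after G1» 2026-09-01: «`γ|B`-semilinear automorphisms of `𝓜ᵢ.total` as automorphisms of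
`(restrictScalars 𝓜ᵢ).total` over `Spec 𝓞 F` with the prescribed generic fibre = exactly how RGD builds MH's `θ` with `_hθ`»), sequel of ★ INT-RES ∕
INT-RES-SHEETS.  HC_CM is proved only modulo the printed citations until rung 0 closes; nothing here is about HC.

THE MATHEMATICS ([GortzWedhorn2020] §(4.8) and (14.20); [SerreTate1968] §1).  Square `A → K`, `B → L`, `L = B ⊗_A K`; `𝓜` a model over `B` of an
`L`-scheme `Z`.  A morphism `u : 𝓜.total → 𝓜.total` of schemes that is `g`-SEMILINEAR for an `A`-algebra automorphism `g` of `B`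
(`u ≫ (𝓜.total → Spec B) = (𝓜.total → Spec B) ≫ Spec g`) is a morphism OVER `Spec A` of the restricted model (`semilinearHom`).  If moreover
`γ : L ≃ₐ[K] L` extends `g` (`γ ∘ (B → L) = (B → L) ∘ g`), `v : Z → Z` over `K` is `γ`-semilinear (`v ≫ Z.hom = Z.hom ≫ Spec γ`) and `u`, `v` AGREE
ON THE GENERIC FIBRE through `𝓜.genericIso` after the projection to `𝓜.total` (`hcompat`), then the generic fibre of `semilinearHom u` through
`(restrictScalars 𝓜).genericIso` IS `v` (`genericFibre_map_semilinearHom` — two maps into `Z = 𝓜.total ×_{Spec B} Spec L` agree iff they agree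
after the projections; the `Spec L`-coordinate is pinned by `Spec L = Spec B ×_{Spec A} Spec K`, Mathlib `IsPullback.hom_ext`).  THICKENING FORM
(number fields `F ⊆ L`, `𝓞 L ⊆ B ⊆ L`, `Z = X ⊗_F L`): for `γ ∈ Gal(L∕F)` and a `(γ⁻¹|B)`-semilinear `u` acting on the generic fibre as the sheet twist
`1 × Spec γ⁻¹` (★ `thickTwist`), the localisation of `semilinearHom u` at `w` has generic fibre ★ `thickeningGalAction γ` in the LITERAL shape of MH's
`_hθ` (`genericFibre_map_localiseMap_semilinearHom_thickening`); hence, by ★ UNIQ-θ (`hom_eq_of_genericFibre_map_comp_genericIso'_eq`, A-p01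
p845095∕p845104), MH's universally quantified `θ(γ, 1)` on the (flat, separated) localised model EQUALS that localisation
(`aut_eq_localiseMap_semilinearHom`) — the moduli meaning of `θ(γ, 1)` (TWIST ∕ EQUIVARIANCE fields of `ModuliDatum`).

## References
* [GortzWedhorn2020] U. Görtz, T. Wedhorn, *Algebraic Geometry I* (2nd ed.), §(4.8) and (14.20) (base change; Galois twists).
* [SerreTate1968] J.-P. Serre, J. Tate, *Good reduction of abelian varieties*, Ann. of Math. 88 (1968), §1.
* [EGAIV3] A. Grothendieck, J. Dieudonné, *ÉGA IV₃*, 11.10 (schematic density of the generic fibre of a flat model).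
-/

set_option autoImplicit false

noncomputable section

set_option backward.isDefEq.respectTransparency false

open CategoryTheory CategoryTheory.Limits AlgebraicGeometry IsDedekindDomain IsDedekindDomain.HeightOneSpectrum
open scoped NumberField nonZeroDivisors
open Literature.NumberTheory.EllipticCurves (genericFibre)
open Literature.AlgebraicGeometry.RelativeSpec (ActionOver)
open scoped NumberField

namespace Literature.AlgebraicGeometry.Motives.IntegralModel

/-! ## §1 Generic square: a `g`-semilinear endomorphism is an `A`-endomorphism of the restriction; its generic fibre -/

section Semilinear

variable {A K B L : Type} [CommRing A] [Field K] [Algebra A K] [CommRing B] [Field L] [Algebra B L]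
  [Algebra A B] [Algebra K L] [Algebra A L] [IsScalarTower A B L] [IsScalarTower A K L] [Algebra.IsPushout A B K L]
  {Z : SchemeOver L} (𝓜 : IntegralModel B L Z)

/-- **A `g`-semilinear endomorphism of `𝓜.total` is an endomorphism of the restricted model over `Spec A`** (`g` is `A`-linear, so
`Spec g ≫ (Spec B → Spec A) = (Spec B → Spec A)`). [cite: GortzWedhorn2020, §(4.8) and (14.20)] -/
def semilinearHom (g : B ≃ₐ[A] B) (u : 𝓜.total.left ⟶ 𝓜.total.left)
    (hu : u ≫ 𝓜.total.hom = 𝓜.total.hom ≫ Spec.map (CommRingCat.ofHom (g : B →+* B))) :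
    (restrictScalars (A := A) (K := K) 𝓜).total ⟶ (restrictScalars (A := A) (K := K) 𝓜).total :=
  Over.homMk u (by
    rw [restrictScalars_total_hom, ← Category.assoc, hu, Category.assoc, ← Spec.map_comp, ← CommRingCat.ofHom_comp]
    congr 3
    ext b
    exact g.commutes b)

/-- The underlying map of `semilinearHom u` is `u`. [cite: GortzWedhorn2020, §(4.8) and (14.20)] -/
@[simp] theorem semilinearHom_left (g : B ≃ₐ[A] B) (u : 𝓜.total.left ⟶ 𝓜.total.left)
    (hu : u ≫ 𝓜.total.hom = 𝓜.total.hom ≫ Spec.map (CommRingCat.ofHom (g : B →+* B))) :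
    (semilinearHom (A := A) (K := K) 𝓜 g u hu).left = u := rfl

/-- The sheet coordinate of the generic fibre of the restricted model: `P := (𝓜.total∕A) ×_A K → Spec L`, pinned by its two projections.
[cite: GortzWedhorn2020, Prop. 4.16 and §(4.8)] -/
private theorem genericIso_hom_left_comp_hom :
    (restrictScalars (A := A) (K := K) 𝓜).genericIso.hom.left ≫ Z.hom =
      (restrictScalarsLeftIso (A := A) (K := K) 𝓜).hom ≫ pullback.snd 𝓜.total.hom (Spec.map (CommRingCat.ofHom (algebraMap B L))) := by
  rw [restrictScalars_genericIso_hom_left, Category.assoc]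
  congr 1
  exact Over.w 𝓜.genericIso.hom

/-- **The generic fibre of a semilinear endomorphism.**  `g : B ≃ₐ[A] B` extended by `γ : L ≃ₐ[K] L` (`hgγ`), `u` `g`-semilinear on `𝓜.total`,
`v` `γ`-semilinear on `Z` over `K` (`hv`), and `u`, `v` compatible on the generic fibre through `𝓜.genericIso` after the projection to `𝓜.total`
(`hcompat`): then `semilinearHom u ⊗_A K`, read through `(restrictScalars 𝓜).genericIso`, is `v`. [cite: GortzWedhorn2020, §(4.8) and (14.20)] -/
theorem genericFibre_map_semilinearHom (g : B ≃ₐ[A] B) (γ : L ≃ₐ[K] L)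
    (hgγ : ∀ b : B, algebraMap B L (g b) = γ (algebraMap B L b))
    (u : 𝓜.total.left ⟶ 𝓜.total.left) (hu : u ≫ 𝓜.total.hom = 𝓜.total.hom ≫ Spec.map (CommRingCat.ofHom (g : B →+* B)))
    (v : SchemeOver.restrictScalars K Z ⟶ SchemeOver.restrictScalars K Z)
    (hv : v.left ≫ Z.hom = Z.hom ≫ Spec.map (CommRingCat.ofHom (γ : L →+* L)))
    (hcompat : 𝓜.genericIso.inv.left ≫ pullback.fst 𝓜.total.hom (Spec.map (CommRingCat.ofHom (algebraMap B L))) ≫ u =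
      v.left ≫ 𝓜.genericIso.inv.left ≫ pullback.fst 𝓜.total.hom (Spec.map (CommRingCat.ofHom (algebraMap B L)))) :
    (baseChange A K).map (semilinearHom (A := A) (K := K) 𝓜 g u hu) ≫ (restrictScalars (A := A) (K := K) 𝓜).genericIso.hom =
      (restrictScalars (A := A) (K := K) 𝓜).genericIso.hom ≫ v := by
  -- the pieces (all in `reassoc` form)
  have A1 := restrictScalars_genericIso_hom_left_comp (A := A) (K := K) 𝓜
  have A3 : ((baseChange A K).map (semilinearHom (A := A) (K := K) 𝓜 g u hu)).left ≫
      pullback.fst (𝓜.total.hom ≫ Spec.map (CommRingCat.ofHom (algebraMap A B))) (Spec.map (CommRingCat.ofHom (algebraMap A K))) =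
      pullback.fst (𝓜.total.hom ≫ Spec.map (CommRingCat.ofHom (algebraMap A B))) (Spec.map (CommRingCat.ofHom (algebraMap A K))) ≫ u :=
    baseChange_map_left_comp_fst (R := K) (semilinearHom (A := A) (K := K) 𝓜 g u hu)
  have A4 : ((baseChange A K).map (semilinearHom (A := A) (K := K) 𝓜 g u hu)).left ≫
      pullback.snd (𝓜.total.hom ≫ Spec.map (CommRingCat.ofHom (algebraMap A B))) (Spec.map (CommRingCat.ofHom (algebraMap A K))) =
      pullback.snd (𝓜.total.hom ≫ Spec.map (CommRingCat.ofHom (algebraMap A B))) (Spec.map (CommRingCat.ofHom (algebraMap A K))) :=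
    Over.w ((baseChange A K).map (semilinearHom (A := A) (K := K) 𝓜 g u hu))
  have hinv : 𝓜.genericIso.inv.left ≫ pullback.snd 𝓜.total.hom (Spec.map (CommRingCat.ofHom (algebraMap B L))) = Z.hom :=
    Over.w 𝓜.genericIso.inv
  have hσ := genericIso_hom_left_comp_hom (A := A) (K := K) 𝓜
  have hγl : Spec.map (CommRingCat.ofHom (γ : L →+* L)) ≫ Spec.map (CommRingCat.ofHom (algebraMap B L)) =
      Spec.map (CommRingCat.ofHom (algebraMap B L)) ≫ Spec.map (CommRingCat.ofHom (g : B →+* B)) := by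
    rw [← Spec.map_comp, ← Spec.map_comp, ← CommRingCat.ofHom_comp, ← CommRingCat.ofHom_comp]
    congr 2
    ext b
    exact (hgγ b).symm
  have hγk : Spec.map (CommRingCat.ofHom (γ : L →+* L)) ≫ Spec.map (CommRingCat.ofHom (algebraMap K L)) =
      Spec.map (CommRingCat.ofHom (algebraMap K L)) := by
    rw [← Spec.map_comp, ← CommRingCat.ofHom_comp]
    congr 2
    ext x
    exact γ.commutes x
  -- the sheet coordinate `σ_P := rSLI.hom ≫ snd` is moved by `Spec γ` under the base-changed semilinear map
  have hsheet : ((baseChange A K).map (semilinearHom (A := A) (K := K) 𝓜 g u hu)).left ≫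
        (restrictScalarsLeftIso (A := A) (K := K) 𝓜).hom ≫ pullback.snd 𝓜.total.hom (Spec.map (CommRingCat.ofHom (algebraMap B L))) =
      (restrictScalarsLeftIso (A := A) (K := K) 𝓜).hom ≫ pullback.snd 𝓜.total.hom (Spec.map (CommRingCat.ofHom (algebraMap B L))) ≫
        Spec.map (CommRingCat.ofHom (γ : L →+* L)) := by
    apply (isPullback_specMap_of_isPushout (A := A) (K := K) (B := B) (L := L)).hom_ext
    · simp only [Category.assoc]
      rw [hγl, ← pullback.condition_assoc, ← pullback.condition, restrictScalarsLeftIso_hom_fst_assoc,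
        restrictScalarsLeftIso_hom_fst_assoc, ← hu, reassoc_of% A3]
    · simp only [Category.assoc]
      rw [hγk, restrictScalarsLeftIso_hom_snd, A4]
  -- assemble: compare after `Z.left ≅ 𝓜.total ×_B Spec L`
  ext : 1
  rw [Over.comp_left, Over.comp_left, ← cancel_mono 𝓜.genericIso.inv.left, Category.assoc, Category.assoc]
  apply pullback.hom_ext
  · simp only [Category.assoc]
    rw [A1, ← hcompat, reassoc_of% A1, A3]
  · simp only [Category.assoc, hinv]
    rw [hv, reassoc_of% hσ, hσ, hsheet]

end Semilinear

/-! ## §2 Number fields: the Galois relabelling of a model over `𝓞 L ⊆ B ⊆ L` and MH's `θ(γ, 1)` -/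

section Thickening

variable {F L : Type} [Field F] [NumberField F] [Field L] [NumberField L] [Algebra F L]
  {B : Type} [CommRing B] [Algebra (𝓞 L) B] [Algebra B L] [IsScalarTower (𝓞 L) B L]
  [Algebra (𝓞 F) B] [IsScalarTower (𝓞 F) B L]
  (hinj : Function.Injective (algebraMap B L)) (w : HeightOneSpectrum (𝓞 F)) (X : SchemeOver F)

/-- **The Galois relabelling as a morphism of the restricted model over `𝓞 F`** (number-field form of `semilinearHom`).
[cite: GortzWedhorn2020, §(4.8) and (14.20)] -/
def semilinearHomOf {Z : SchemeOver L} (𝓜 : IntegralModel B L Z) (g : B ≃ₐ[𝓞 F] B) (u : 𝓜.total.left ⟶ 𝓜.total.left)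
    (hu : u ≫ 𝓜.total.hom = 𝓜.total.hom ≫ Spec.map (CommRingCat.ofHom (g : B →+* B))) :
    (restrictScalarsOfIntermediate (F := F) hinj 𝓜).total ⟶ (restrictScalarsOfIntermediate (F := F) hinj 𝓜).total :=
  haveI := isPushout_of_injective (F := F) hinj
  semilinearHom (A := 𝓞 F) (K := F) 𝓜 g u hu

/-- Its underlying map is `u`. [cite: GortzWedhorn2020, §(4.8) and (14.20)] -/
@[simp] theorem semilinearHomOf_left {Z : SchemeOver L} (𝓜 : IntegralModel B L Z) (g : B ≃ₐ[𝓞 F] B) (u : 𝓜.total.left ⟶ 𝓜.total.left)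
    (hu : u ≫ 𝓜.total.hom = 𝓜.total.hom ≫ Spec.map (CommRingCat.ofHom (g : B →+* B))) :
    (semilinearHomOf (F := F) hinj 𝓜 g u hu).left = u := rfl

/-- **The generic fibre of the (localised) Galois relabelling is the Galois action of the thickening — MH's `_hθ` literal.**  Data: `γ ∈ Gal(L∕F)`,
`g : B ≃ₐ[𝓞 F] B` the restriction of `γ⁻¹` to `B` (`hg`), `u` a `g`-semilinear endomorphism of the model `𝓜` of `X ⊗_F L` over `B` (in print: the
moduli relabelling `(A, ι, λ, η; ε) ↦ (A, ι, λ, η; ε ∘ γ)`), acting on the generic fibre as the sheet twist `1 × Spec γ⁻¹` (`hcompat`, through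
`𝓜.genericIso` after the projection to `𝓜.total`).  Then at every `w` the localisation of `semilinearHomOf u` has generic fibre
★ `thickeningGalAction γ` through `genericIso'`. [cite: GortzWedhorn2020, §(4.8) and (14.20)] [cite: SerreTate1968, §1] -/
theorem genericFibre_map_localiseMap_semilinearHomOf (𝓜 : IntegralModel B L ((baseChange F L).obj X)) (γ : L ≃ₐ[F] L) (g : B ≃ₐ[𝓞 F] B)
    (hg : ∀ b : B, algebraMap B L (g b) = γ⁻¹ (algebraMap B L b))
    (u : 𝓜.total.left ⟶ 𝓜.total.left) (hu : u ≫ 𝓜.total.hom = 𝓜.total.hom ≫ Spec.map (CommRingCat.ofHom (g : B →+* B)))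
    (hcompat : 𝓜.genericIso.inv.left ≫ pullback.fst 𝓜.total.hom (Spec.map (CommRingCat.ofHom (algebraMap B L))) ≫ u =
      thickTwist X γ⁻¹ ≫ 𝓜.genericIso.inv.left ≫ pullback.fst 𝓜.total.hom (Spec.map (CommRingCat.ofHom (algebraMap B L)))) :
    (genericFibre (valuationSubringAtPrime F w) F).map
          (localiseMap _ _ (semilinearHomOf (F := F) hinj 𝓜 g u hu) w) ≫
        ((restrictScalarsOfIntermediate (F := F) hinj 𝓜).localise w).genericIso'.hom =
      ((restrictScalarsOfIntermediate (F := F) hinj 𝓜).localise w).genericIso'.hom ≫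
        (Over.isoMk ((thickeningGalAction (L := L) X).aut γ) ((thickeningGalAction (L := L) X).aut_comp γ)).hom := by
  haveI := isPushout_of_injective (F := F) hinj
  have hgen := genericFibre_map_semilinearHom (A := 𝓞 F) (K := F) 𝓜 g γ⁻¹ hg u hu
    (Over.isoMk ((thickeningGalAction (L := L) X).aut γ) ((thickeningGalAction (L := L) X).aut_comp γ)).hom
    (by
      change thickTwist X γ⁻¹ ≫ pullback.snd X.hom (AbelianVariety.bcSpec F L) = pullback.snd X.hom (AbelianVariety.bcSpec F L) ≫ _
      exact thickTwist_snd X γ⁻¹)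
    hcompat
  exact genericFibre_map_localiseMap _ _ (semilinearHomOf (F := F) hinj 𝓜 g u hu) _ hgen w

/-- **MH's `θ(γ, 1)` IS the localised Galois relabelling** (★ UNIQ-θ, A-p01 `hom_eq_of_genericFibre_map_comp_genericIso'_eq`): on the flat separated
localised model `𝓨 := (restrictScalarsOfIntermediate hinj 𝓜).localise w`, ANY action `θ` of `(L ≃ₐ[F] L) × G` whose `Γ`-part has generic fibre the
Galois action of the thickening (MH's `_hθ`) satisfies `θ(γ, 1) = (semilinearHomOf u_γ) ⊗ 𝒪_(w)` for the Galois relabelling `u_γ` as above — the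
moduli meaning of `θ(γ, 1)` (TWIST ∕ EQUIVARIANCE fields of `ModuliDatum`). [cite: EGAIV3, 11.10.5 and 11.10.1] [cite: GortzWedhorn2020, (14.20)] -/
theorem isoMk_aut_hom_eq_localiseMap_semilinearHomOf {G : Type*} [Group G] (𝓜 : IntegralModel B L ((baseChange F L).obj X)) (γ : L ≃ₐ[F] L)
    (g : B ≃ₐ[𝓞 F] B) (hg : ∀ b : B, algebraMap B L (g b) = γ⁻¹ (algebraMap B L b))
    (u : 𝓜.total.left ⟶ 𝓜.total.left) (hu : u ≫ 𝓜.total.hom = 𝓜.total.hom ≫ Spec.map (CommRingCat.ofHom (g : B →+* B)))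
    (hcompat : 𝓜.genericIso.inv.left ≫ pullback.fst 𝓜.total.hom (Spec.map (CommRingCat.ofHom (algebraMap B L))) ≫ u =
      thickTwist X γ⁻¹ ≫ 𝓜.genericIso.inv.left ≫ pullback.fst 𝓜.total.hom (Spec.map (CommRingCat.ofHom (algebraMap B L))))
    [Flat ((restrictScalarsOfIntermediate (F := F) hinj 𝓜).localise w).total.hom]
    [IsSeparated ((restrictScalarsOfIntermediate (F := F) hinj 𝓜).localise w).total.hom]
    (θ : ActionOver ((restrictScalarsOfIntermediate (F := F) hinj 𝓜).localise w).total.hom ((L ≃ₐ[F] L) × G))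
    (hθ : ∀ γ' : L ≃ₐ[F] L,
      (genericFibre (valuationSubringAtPrime F w) F).map (Over.isoMk (θ.aut (γ', 1)) (θ.aut_comp (γ', 1))).hom ≫
          ((restrictScalarsOfIntermediate (F := F) hinj 𝓜).localise w).genericIso'.hom =
        ((restrictScalarsOfIntermediate (F := F) hinj 𝓜).localise w).genericIso'.hom ≫
          (Over.isoMk ((thickeningGalAction (L := L) X).aut γ') ((thickeningGalAction (L := L) X).aut_comp γ')).hom) :
    (Over.isoMk (θ.aut (γ, 1)) (θ.aut_comp (γ, 1))).hom = localiseMap _ _ (semilinearHomOf (F := F) hinj 𝓜 g u hu) w :=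
  hom_eq_of_genericFibre_map_comp_genericIso'_eq _ _ _ _
    ((hθ γ).trans (genericFibre_map_localiseMap_semilinearHomOf hinj w X 𝓜 γ g hg u hu hcompat).symm)

end Thickening

end Literature.AlgebraicGeometry.Motives.IntegralModel
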